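import Literature.MathematicalPhysics.QuantumFieldTheory.Balaban1983to89.Node00.OpsYDeltaALocal
import Literature.MathematicalPhysics.QuantumFieldTheory.Balaban1983to89.Node00.OpsYLocalInverseAgree

/-!
# `Balaban1983to89.Node00.OpsYDeltaALocalAgree` — THE LOCALISED BOND OPERATOR `Δ_{a,□}(U)` OF (3.105), COMPRESSED TO A CUBE, READS `U`
# LOCALLY: `M_χ Δ_{a,□}(U) M_χ = M_χ Δ_{a,□}(U′) M_χ`, hence `G_□(U) = G_□(U′)`, whenever `U = U′` on the bonds the letters read
# (def-Y, file A-3 of the NODE 00 locality series — the bond-sector twin of A-1 `OpsYLocalInverseAgree`; definitions with bodies + theorems; NO estimate)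

FRAMING (verbatim cell line):
statement-level skeleton of published theorems with citation tags; proofs where landed; nothing here is a claim about the Yang–Mills mass gap

Sources: T. Bałaban, *Propagators for lattice gauge theories in a background field*, Commun. Math. Phys. **99** (1985) 389–434
[`Balaban1985BackgroundPropagators`, "[B9]"]: (3.1)–(3.4) pp. 390–391, (3.7)–(3.10) pp. 391–392 (the Hessian `Δ(U)`), (3.12)–(3.14) p. 393
(`Q(U)`, `Q*(U)`), (3.21), (3.24)–(3.26) pp. 394–395 (`Q′(U)`, `R(U)`, `Δ_a(U)`), (3.40) p. 397 (the contours `Γ`), (3.105) p. 414 and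
pp. 408–409 (`Δ_{a,□}`, `G_□`, `C_□`, `Ω_j(□)`), p. 410 l. 14–15: «the operators `G′_□(U)` … depend on `U` restricted to `Ω₀(□) ⊂ □̃⁵`»,
p. 416 (the road to (3.35) on a cube: `U ↦ U^{u′}` agreeing with the straightened field near □̃).  Unit `pub-ymgap-node00-def-Y` (g22), typed on
dag-n06-j g23's FACE WANTED (d) (bus I.37942) for the composition «n10-w3 L5 + n06-j F4b + (d) ⇒ `hloc` on (3.35)».

## WHAT IS PRINTED AND WHAT IS SILENT

Print states the locality of the cube letters in one clause (p. 410 l. 14–15) and uses it on p. 416 to replace `U` by a configuration that agrees with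
it near □̃.  For def-Y's letters (`Node00.OpsYDeltaA`: every covariant letter is a TRANSPORTED LIFT `trLiftY M T` of a flat kernel along a
transporter table, (3.3) ff.) the clause is a finite list of READINGS: `(M♯_T Λ)(y)` reads `T(y, x)` only where `M(y, x) ≠ 0` and `Λ(x) ≠ 0` (§1).
This file writes that list out, letter by letter, and assembles it for the compression `M_χ Δ_{a,□}(U) M_χ` of W-a∕def-Y's `OpsYDeltaALocal` (FILE 40).
The GEOMETRIC half («those readings lie in □̃³ ⊂ Ω_j(□)», p. 408) is kernel-support geometry of the cube cover — dag-n06-j's `B9Eq335CubeDomCoverP`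
and r05's `B9CubeBondRowAgreementNearH` (`ends_of_qK_ne_zero`, `lvl_le_of_qK_ne_zero_of_hT`), `B9Eq3104CutoffCommutatorSizes.curlK_ne_zero_imp ∕
qpK_ne_zero_imp ∕ qpsK_ne_zero_imp` — and is NOT asserted here: the agreement predicates below are phrased over the kernel supports themselves.

## WHAT THIS FILE CERTIFIES (kernel-checked; 6 definitions with bodies, theorems; 0 facts, 0 estimates)

§1 `trLiftY_apply_congr` ∕ `'` — pointwise locality of the transported lift (with `B9Eq39Adjoint.R_zero`).
§2 per letter, POINTWISE: `PlaqAgreeY i U U′ p` (U = U′ on the four edges of `p`); `holY ∕ reHolY ∕ imHolY ∕ curlT ∕ edgeParY ∕ primeEdgeY _congr`,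
`curlY ∕ jordanY ∕ coCurlY ∕ curv2Y _apply_congr`, ★ `hessY_apply_congr` (`(Δ(U)A)(b)` reads the edges of the plaquettes of `b`'s rows);
`gradT_congr`, `gradY ∕ divY _apply_congr`; `QY ∕ QsY _apply_congr` (the contour transporters `parB U (x(y), b₋)` on the `Q`-rows);
`QpY_comp_cubeProjY_congr`, `cubeProjY_comp_QpsY_congr` (`Q′P_D`, `P_DQ′*` read `parS U (c(s), z)` at `z ∈ D` only).
§3 OPERATOR-level locality of the site chain: `QpAgreeY`; `XY_GsqY_eq ∕ _congr` (`X_□ = (Q′P_D)G′_□G′_□(P_DQ′*)`), ★ `ClocY_congr`, `PlocY_eq ∕ _congr`,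
★★ `RlocY_congr` — `R_□(U) = R_□(U′)` from `G′_□(U) = G′_□(U′)` (A-1) and `Q′`-transport agreement at `D`; `qpAgreeY_of_parLocalY`.
§4 `QAgreeY`, `PlaqAgreeNearY`, `BondAgreeY`; ★★★ `compr_deltaALocY_congr` — `M_χ Δ_{a,□}(U) M_χ = M_χ Δ_{a,□}(U′) M_χ` for EVERY `parS`, `parB`,
block projection `P`, cut-off `χ`, from `R_□(U) = R_□(U′)` + bond ∕ plaquette ∕ `Q`-transport agreement on `supp χ`; `padDeltaALocY_congr`,
`GAsqY_congr` (FILE 40's `GAsqY_congr_of_compr`), `isUnit_padDeltaALocY_iff`.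
§5 at the record's letters `parSymY` (R7) ∕ `parBY`: `parBY_congr_of_agree`; ★★ `AgreeNearBY i D χ U U′` (clauses (i)–(v): A-1's `AgreeNearY`, bonds
of `supp χ`, plaquettes around `supp χ`, taxi rungs of the `Q`-rows through `supp χ`, taxi runs of the `Q′`-rows through `D`), `.qAgreeY`,
`.rlocY_parSymY`, ★★★ `padDeltaALocY_parSymY_congr`, `compr_deltaALocY_parSymY_congr`, `GAsqY_parSymY_congr`, `isUnit_padDeltaALocY_parSymY_iff`,
`AgreeNearBY.symm ∕ .mono`.

## HONEST SCOPE
* Definitional locality only: which variables `U(b)` the letters read.  No inequality of [B9] (Thm 3.3, Cor. 3.6, (3.35), (3.105)'s smallness) is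
  asserted or used; invertibility of the padded compressions is neither assumed nor concluded (the unit loci are merely shown equal).
* The block projection `P` is arbitrary: `C_□(U)`'s `U`-dependence is operator-level (§3), so no block cut-off enters the predicate.
* SIBLINGS, NOT RESTATED: A-1 `OpsYLocalInverseAgree` (the site letter `G′_□`; imported and used), r05 `B9CubeBondRowAgreementNearH` (member rows
  versus CUBE-SEQUENCE rows of `Q*aQ` at one `U` — a different comparison), `B9Cor36GpCubeLocLetter` (locality in the ARGUMENT `Λ`, not in `U`).
* Nothing is inferred from the manuscript beyond the displayed formulas; kernel-checked.  NOT summit progress: N06 is not discharged by this file;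
  no continuum limit, no OS axioms, no mass gap, no claim on the Clay problem.
-/

namespace Literature.MathematicalPhysics.QuantumFieldTheory.Balaban1983to89.Node00.OpsYDeltaALocalAgree

open B6KLevelCensusIndexV1 (KIdx)
open B6GlobalChartV1 (PV boxEquiv)
open B9Eq39Adjoint (R R_def R_zero)
open B9Eq340StepLasso (rungSites taxiSteps)
open B15DeterminingSets (embIter)
open B9Thm37CubeCoverCommutators (cutMulY cutMulY_apply)
open OpsYLocalInverse (GsqY cubeProjY cubeProjY_apply cubeProjY_mul_GsqY GsqY_mul_cubeProjY dirPadY)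
open OpsYLocalInverseAgree (AgreeRunY ParLocalY AgreeNearY parLocalY_parSymY GsqY_congr_of_parLocalY parTaxiV_congr_of_agree)
open OpsYDeltaALocal (ClocY PlocY RlocY deltaALocY padDeltaALocY GAsqY ClocY_congr_of_compr GAsqY_congr_of_compr)

variable {𝔸 : Type} [NormedRing 𝔸] [NormedAlgebra ℂ 𝔸] [CompleteSpace 𝔸]

/-! ## §1 The transported lift reads its transporters only on the kernel's support and where the argument is non-zero -/

section General

variable {X Y : Type} [Fintype X]

omit [CompleteSpace 𝔸] in
/-- ★ **POINTWISE LOCALITY OF THE TRANSPORTED LIFT**: `(M♯_T Λ)(y)` reads the transporter `T(y, x)` only at the `x` with `M(y, x) ≠ 0` AND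
`Λ(x) ≠ 0`, and `Λ` only on the row support of `M(y, ·)`. [cite: Balaban1985BackgroundPropagators, (3.3) p.390, (3.12)–(3.14) p.393, bookkeeping] -/
theorem trLiftY_apply_congr {M : Matrix Y X ℝ} {T T' : Y → X → 𝔸ˣ} {Λ Λ' : X → 𝔸} {y : Y}
    (h : ∀ x, M y x ≠ 0 → Λ x = Λ' x ∧ (Λ x ≠ 0 → T y x = T' y x)) : trLiftY M T Λ y = trLiftY M T' Λ' y := by
  rw [trLiftY_apply, trLiftY_apply]
  refine Finset.sum_congr rfl fun x _ => ?_
  by_cases hM : M y x = 0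
  · simp [hM]
  · obtain ⟨hΛ, hT⟩ := h x hM
    rw [← hΛ]
    by_cases hx : Λ x = 0
    · rw [hx, R_zero, R_zero]
    · rw [hT hx]

omit [CompleteSpace 𝔸] in
/-- the same with unconditional transporter agreement on the row support. [cite: Balaban1985BackgroundPropagators, (3.3) p.390, bookkeeping] -/
theorem trLiftY_apply_congr' {M : Matrix Y X ℝ} {T T' : Y → X → 𝔸ˣ} {Λ Λ' : X → 𝔸} {y : Y}
    (h : ∀ x, M y x ≠ 0 → Λ x = Λ' x ∧ T y x = T' y x) : trLiftY M T Λ y = trLiftY M T' Λ' y :=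
  trLiftY_apply_congr fun x hx => ⟨(h x hx).1, fun _ => (h x hx).2⟩

end General

/-! ## §2 The letters of `Δ_{a,□}(U)` read `U` locally: pointwise congruences -/

section Letters

variable {d ℓ : ℕ} {hd : 1 ≤ d + 1} {hL : Odd (ℓ + 1) ∧ 1 < ℓ + 1} {b₀ b₁ : ℝ}
variable (i : KIdx d ℓ hd hL b₀ b₁)

/-- **plaquette agreement**: `U = U′` on the four edges `⟨p₋, μ⟩, ⟨p₋, ν⟩, ⟨p₋ + e_μ, ν⟩, ⟨p₋ + e_ν, μ⟩` of the plaquette `p` — exactly the bond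
variables the plaquette letters `U(∂p)`, the curl transporters (3.4) and the primed-variable transporters (3.2) read.
[cite: Balaban1985BackgroundPropagators, (3.1)–(3.2) p.390, (3.4) p.391, dictionary] -/
def PlaqAgreeY (U U' : CfgY 𝔸 i) (p : PlaqY i) : Prop :=
  U p.μ p.src = U' p.μ p.src ∧ U p.ν p.src = U' p.ν p.src ∧
    U p.ν (p.src.shift p.μ) = U' p.ν (p.src.shift p.μ) ∧ U p.μ (p.src.shift p.ν) = U' p.μ (p.src.shift p.ν)

variable {i}

/-- `PlaqAgreeY` is symmetric in the configurations. [cite: Balaban1985BackgroundPropagators, (3.1) p.390, bookkeeping] -/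
theorem PlaqAgreeY.symm {U U' : CfgY 𝔸 i} {p : PlaqY i} (h : PlaqAgreeY i U U' p) : PlaqAgreeY i U' U p :=
  ⟨h.1.symm, h.2.1.symm, h.2.2.1.symm, h.2.2.2.symm⟩

/-- the plaquette holonomy `U(∂p)` reads the four edges of `p`. [cite: Balaban1985BackgroundPropagators, (3.1) p.390] -/
theorem holY_congr {U U' : CfgY 𝔸 i} {p : PlaqY i} (h : PlaqAgreeY i U U' p) : holY i U p = holY i U' p := by
  unfold holY
  rw [h.1, h.2.1, h.2.2.1, h.2.2.2]

/-- `Re U(∂p)` reads the four edges of `p`. [cite: Balaban1985BackgroundPropagators, (3.7) p.391] -/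
theorem reHolY_congr {U U' : CfgY 𝔸 i} {p : PlaqY i} (h : PlaqAgreeY i U U' p) : reHolY i U p = reHolY i U' p := by
  unfold reHolY
  rw [holY_congr h]

/-- `Im U(∂p)` reads the four edges of `p`. [cite: Balaban1985BackgroundPropagators, (3.7) p.391] -/
theorem imHolY_congr {U U' : CfgY 𝔸 i} {p : PlaqY i} (h : PlaqAgreeY i U U' p) : imHolY i U p = imHolY i U' p := by
  unfold imHolY
  rw [holY_congr h]

/-- the curl transporters (3.4) of `p` read the two edges of `p` at `p₋`. [cite: Balaban1985BackgroundPropagators, (3.4) p.391] -/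
theorem curlT_congr {U U' : CfgY 𝔸 i} {p : PlaqY i} (h : PlaqAgreeY i U U' p) (b : FBondY i) : curlT i U p b = curlT i U' p b := by
  unfold curlT
  rw [h.1, h.2.1]

/-- the primed-variable transporters (3.2) of `p` read the two edges of `p` at `p₋`. [cite: Balaban1985BackgroundPropagators, (3.2) p.390] -/
theorem edgeParY_congr {U U' : CfgY 𝔸 i} {p : PlaqY i} (h : PlaqAgreeY i U U' p) : edgeParY i U p = edgeParY i U' p := by
  unfold edgeParY
  rw [h.1, h.2.1]

/-- the primed contour functional `A ↦ A′(b_m)` reads `U` on the edges of `p`. [cite: Balaban1985BackgroundPropagators, (3.2) p.390] -/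
theorem primeEdgeY_congr {U U' : CfgY 𝔸 i} {p : PlaqY i} (h : PlaqAgreeY i U U' p) (m : Fin 4) :
    primeEdgeY i U p m = primeEdgeY i U' p m := by
  unfold primeEdgeY
  rw [edgeParY_congr h]

/-- ★ the covariant curl `(D_U A)(p)` reads `U` on the edges of `p` (and `A` on the curl row of `p`). [cite: Balaban1985BackgroundPropagators, (3.4) p.391] -/
theorem curlY_apply_congr {U U' : CfgY 𝔸 i} {p : PlaqY i} (h : PlaqAgreeY i U U' p) (Λ : FBondY i → 𝔸) :
    curlY i U Λ p = curlY i U' Λ p :=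
  trLiftY_apply_congr' fun b _ => ⟨rfl, curlT_congr h b⟩

/-- the Jordan insertion `(𝒦_U F)(p) = ½(F(p)·Re U(∂p) + Re U(∂p)·F(p))` reads `U` on the edges of `p` and `F` at `p`.
[cite: Balaban1985BackgroundPropagators, (3.7) p.391, (3.10) p.392] -/
theorem jordanY_apply_congr {U U' : CfgY 𝔸 i} {p : PlaqY i} (h : PlaqAgreeY i U U' p) {F F' : PlaqY i → 𝔸} (hF : F p = F' p) :
    jordanY i U F p = jordanY i U' F' p := by
  simp only [jordanY, LinearMap.smul_apply, Pi.smul_apply, LinearMap.pi_apply, LinearMap.coe_comp, Function.comp_apply,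
    LinearMap.proj_apply, LinearMap.add_apply, LinearMap.mulRight_apply, LinearMap.mulLeft_apply]
  rw [hF, reHolY_congr h]

/-- ★ the co-curl `(D*_U F)(b)` reads `U` on the edges of the plaquettes of the co-curl row of `b`, and `F` there.
[cite: Balaban1985BackgroundPropagators, (3.9) p.392] -/
theorem coCurlY_apply_congr {U U' : CfgY 𝔸 i} {b : FBondY i} {F F' : PlaqY i → 𝔸}
    (h : ∀ p, cocurlK i b p ≠ 0 → PlaqAgreeY i U U' p ∧ F p = F' p) : coCurlY i U F b = coCurlY i U' F' b :=
  trLiftY_apply_congr' fun p hp => ⟨(h p hp).2, by rw [curlT_congr (h p hp).1 b]⟩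

/-- ★ the commutator part `(Δ′₂(U)A)(b)` of the curvature operator reads `U` on the edges of the plaquettes through `b`.
[cite: Balaban1985BackgroundPropagators, (3.10) p.392] -/
theorem curv2Y_apply_congr {U U' : CfgY 𝔸 i} {b : FBondY i} (h : ∀ p m, edgeY i p m = b → PlaqAgreeY i U U' p) (Λ : FBondY i → 𝔸) :
    curv2Y i U Λ b = curv2Y i U' Λ b := by
  simp only [curv2Y, LinearMap.smul_apply, Pi.smul_apply, LinearMap.pi_apply]
  congr 2
  refine Finset.sum_congr rfl fun p _ => Finset.sum_congr rfl fun m _ => ?_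
  by_cases hpm : edgeY i p m = b
  · have hp := h p m hpm
    rw [if_pos hpm, if_pos hpm, edgeParY_congr hp, imHolY_congr hp]
    simp only [primeEdgeY_congr hp]
  · rw [if_neg hpm, if_neg hpm]

/-- ★★ **THE HESSIAN `(Δ(U)A)(b)` OF (3.10) READS `U` ON THE EDGES OF THE PLAQUETTES AROUND `b`** (those of its co-curl row and those through `b`).
[cite: Balaban1985BackgroundPropagators, (3.10) p.392, p.410 L14–15 (locality of the letters), dictionary] -/
theorem hessY_apply_congr {U U' : CfgY 𝔸 i} {b : FBondY i}
    (h : ∀ p, (cocurlK i b p ≠ 0 ∨ ∃ m, edgeY i p m = b) → PlaqAgreeY i U U' p) (Λ : FBondY i → 𝔸) :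
    hessY i U Λ b = hessY i U' Λ b := by
  simp only [hessY, LinearMap.add_apply, Pi.add_apply, LinearMap.coe_comp, Function.comp_apply]
  rw [coCurlY_apply_congr (F := jordanY i U (curlY i U Λ)) (F' := jordanY i U' (curlY i U' Λ)) fun p hp =>
      ⟨h p (Or.inl hp), jordanY_apply_congr (h p (Or.inl hp)) (curlY_apply_congr (h p (Or.inl hp)) Λ)⟩,
    curv2Y_apply_congr (fun p m hpm => h p (Or.inr ⟨m, hpm⟩)) Λ]

/-- the gradient transporters (3.3) of `b` read `U(b)` only. [cite: Balaban1985BackgroundPropagators, (3.3) p.390] -/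
theorem gradT_congr {U U' : CfgY 𝔸 i} {b : FBondY i} (hb : U b.dir b.src = U' b.dir b.src) (z : SiteY i) : gradT i U b z = gradT i U' b z := by
  unfold gradT
  rw [hb]

/-- ★ the covariant gradient `(D_Uλ)(b)` reads `U(b)` only (and `λ` on the gradient row of `b`). [cite: Balaban1985BackgroundPropagators, (3.3) p.390] -/
theorem gradY_apply_congr {U U' : CfgY 𝔸 i} {b : FBondY i} (hb : U b.dir b.src = U' b.dir b.src) {Λ Λ' : SiteY i → 𝔸}
    (hΛ : ∀ z, gradK i b z ≠ 0 → Λ z = Λ' z) : gradY i U Λ b = gradY i U' Λ' b :=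
  trLiftY_apply_congr' fun z hz => ⟨hΛ z hz, gradT_congr hb z⟩

/-- ★ the covariant divergence `(D*_U A)(z)` reads `U(b)` only at the bonds `b` of its row where `A(b) ≠ 0`.
[cite: Balaban1985BackgroundPropagators, (3.8) p.392] -/
theorem divY_apply_congr {U U' : CfgY 𝔸 i} {z : SiteY i} {Λ Λ' : FBondY i → 𝔸}
    (h : ∀ b, divK i z b ≠ 0 → Λ b = Λ' b ∧ (Λ b ≠ 0 → U b.dir b.src = U' b.dir b.src)) : divY i U Λ z = divY i U' Λ' z :=
  trLiftY_apply_congr fun b hb => ⟨(h b hb).1, fun hΛ => by rw [gradT_congr ((h b hb).2 hΛ) z]⟩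

/-- ★ the covariant averaging `(Q(U)A)(y)` reads the contour transporters `parB U (x(y), b₋)` only at the bonds `b` of its row where `A(b) ≠ 0`.
[cite: Balaban1985BackgroundPropagators, (3.12)–(3.14) p.393] -/
theorem QY_apply_congr {parB : BondParY 𝔸 i} {U U' : CfgY 𝔸 i} {ι : IBondY i} {Λ Λ' : FBondY i → 𝔸}
    (h : ∀ b, qK i ι b ≠ 0 → Λ b = Λ' b ∧
      (Λ b ≠ 0 → parB U (embIter (ι.1.1 : ℕ) ι.1.2.src) b.src = parB U' (embIter (ι.1.1 : ℕ) ι.1.2.src) b.src)) :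
    QY i parB U Λ ι = QY i parB U' Λ' ι :=
  trLiftY_apply_congr fun b hb => ⟨(h b hb).1, fun hΛ => (h b hb).2 hΛ⟩

/-- ★ the adjoint averaging `(Q*(U)B)(b)` reads the contour transporters `parB U (x(y), b₋)` at the index bonds `y` of its row, and `B` there.
[cite: Balaban1985BackgroundPropagators, (3.13) p.393] -/
theorem QsY_apply_congr {parB : BondParY 𝔸 i} {U U' : CfgY 𝔸 i} {b : FBondY i} {v v' : IBondY i → 𝔸}
    (h : ∀ ι, qK i ι b ≠ 0 → v ι = v' ι ∧ parB U (embIter (ι.1.1 : ℕ) ι.1.2.src) b.src = parB U' (embIter (ι.1.1 : ℕ) ι.1.2.src) b.src) :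
    QsY i parB U v b = QsY i parB U' v' b := by
  rw [QsY_eq_transpose, QsY_eq_transpose]
  exact trLiftY_apply_congr' fun ι hι => ⟨(h ι hι).1, by unfold qT; rw [(h ι hι).2]⟩

/-- ★ the covariant block averaging `Q′(U)` composed with the cube projection `P_D` reads the transporters `parS U (c(s), z)` only at `z ∈ D`.
[cite: Balaban1985BackgroundPropagators, (3.21) p.394, p.410 L14–15] -/
theorem QpY_comp_cubeProjY_congr {parS : SiteParY 𝔸 i} {D : Finset (SiteY i)} {U U' : CfgY 𝔸 i}
    (h : ∀ z ∈ D, ∀ s, qpK i s z ≠ 0 → parS U (blkCornerY i s) z = parS U' (blkCornerY i s) z) :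
    QpY i parS U ∘ₗ cubeProjY i D = QpY i parS U' ∘ₗ cubeProjY i D := by
  refine LinearMap.ext fun Λ => funext fun s => ?_
  simp only [LinearMap.coe_comp, Function.comp_apply]
  refine trLiftY_apply_congr fun z hz => ⟨rfl, fun hΛ => ?_⟩
  have hzD : z ∈ D := by
    by_contra hzD
    exact hΛ (by rw [cubeProjY_apply, if_neg hzD])
  unfold qpT
  rw [h z hzD s hz]

/-- ★ the cube projection composed with `Q′*(U)` reads the transporters `parS U (c(s), z)` only at `z ∈ D`.
[cite: Balaban1985BackgroundPropagators, (3.24) p.395, p.410 L14–15] -/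
theorem cubeProjY_comp_QpsY_congr {parS : SiteParY 𝔸 i} {D : Finset (SiteY i)} {U U' : CfgY 𝔸 i}
    (h : ∀ z ∈ D, ∀ s, qpsK i z s ≠ 0 → parS U (blkCornerY i s) z = parS U' (blkCornerY i s) z) :
    cubeProjY i D ∘ₗ QpsY i parS U = cubeProjY i D ∘ₗ QpsY i parS U' := by
  refine LinearMap.ext fun Λ => funext fun z => ?_
  simp only [LinearMap.coe_comp, Function.comp_apply, cubeProjY_apply]
  by_cases hzD : z ∈ D
  · rw [if_pos hzD, if_pos hzD]
    exact trLiftY_apply_congr' fun s hs => ⟨rfl, by unfold qpT; rw [h z hzD s hs]⟩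
  · rw [if_neg hzD, if_neg hzD]

/-! ## §3 The site chain `G′_□`, `X_□ = Q′G′_□²Q′*`, `C_□`, `P_□`, `R_□` is OPERATOR-level local in `U` -/

variable (i) in
/-- **`Q′`-transport agreement at `D`**: the block-averaging transporters `parS U (c(s), z)` agree at every `z ∈ D` on the rows of `Q′`, `Q′*`
through `z`. [cite: Balaban1985BackgroundPropagators, (3.21) p.394, (3.24) p.395, p.410 L14–15, dictionary] -/
def QpAgreeY (parS : SiteParY 𝔸 i) (D : Finset (SiteY i)) (U U' : CfgY 𝔸 i) : Prop :=
  ∀ z ∈ D, ∀ s, (qpK i s z ≠ 0 ∨ qpsK i z s ≠ 0) → parS U (blkCornerY i s) z = parS U' (blkCornerY i s) z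

/-- `X_□(U) = Q′(U)G′_□(U)²Q′*(U)` with the cube projections made explicit: `(Q′P_D) G′_□ G′_□ (P_D Q′*)` (`P_D G′_□ = G′_□ = G′_□ P_D`).
[cite: Balaban1985BackgroundPropagators, (3.25) p.395, pp.408–409 (G′_□), bookkeeping] -/
theorem XY_GsqY_eq (parS : SiteParY 𝔸 i) (D : Finset (SiteY i)) (U : CfgY 𝔸 i) :
    XY i parS (GsqY i parS D) U =
      (QpY i parS U ∘ₗ cubeProjY i D) ∘ₗ GsqY i parS D U ∘ₗ GsqY i parS D U ∘ₗ (cubeProjY i D ∘ₗ QpsY i parS U) := by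
  have e1 : cubeProjY i D ∘ₗ GsqY i parS D U = GsqY i parS D U := cubeProjY_mul_GsqY i parS D U
  have e2 : GsqY i parS D U ∘ₗ cubeProjY i D = GsqY i parS D U := GsqY_mul_cubeProjY i parS D U
  symm
  rw [LinearMap.comp_assoc, ← LinearMap.comp_assoc (QpsY i parS U) (cubeProjY i D) (GsqY i parS D U), e2,
    ← LinearMap.comp_assoc _ (GsqY i parS D U) (cubeProjY i D), e1, XY]

/-- ★ **`X_□(U)` IS LOCAL**: it depends on `U` only through `G′_□(U)` and the `Q′`-transporters at `D`.
[cite: Balaban1985BackgroundPropagators, (3.25) p.395, p.410 L14–15] -/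
theorem XY_GsqY_congr {parS : SiteParY 𝔸 i} {D : Finset (SiteY i)} {U U' : CfgY 𝔸 i}
    (hG : GsqY i parS D U = GsqY i parS D U') (hQ : QpAgreeY i parS D U U') :
    XY i parS (GsqY i parS D) U = XY i parS (GsqY i parS D) U' := by
  rw [XY_GsqY_eq, XY_GsqY_eq, QpY_comp_cubeProjY_congr fun z hz s hs => hQ z hz s (Or.inl hs),
    cubeProjY_comp_QpsY_congr fun z hz s hs => hQ z hz s (Or.inr hs), hG]

/-- ★ **`C_□(U)` IS LOCAL** (for every block projection `P`). [cite: Balaban1985BackgroundPropagators, pp.408–409 (C_□), p.410 L14–15] -/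
theorem ClocY_congr {parS : SiteParY 𝔸 i} {D : Finset (SiteY i)} (P : Module.End ℂ (BlkY i → 𝔸)) {U U' : CfgY 𝔸 i}
    (hG : GsqY i parS D U = GsqY i parS D U') (hQ : QpAgreeY i parS D U U') : ClocY i parS D P U = ClocY i parS D P U' :=
  ClocY_congr_of_compr i parS D (by rw [XY_GsqY_congr hG hQ])

/-- `P_□(U)` with the cube projections made explicit: `G′_□ (P_D Q′*) C_□ (Q′ P_D) G′_□`. [cite: Balaban1985BackgroundPropagators, (3.105) p.414, bookkeeping] -/
theorem PlocY_eq (parS : SiteParY 𝔸 i) (D : Finset (SiteY i)) (P : Module.End ℂ (BlkY i → 𝔸)) (U : CfgY 𝔸 i) :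
    PlocY i parS D P U =
      GsqY i parS D U ∘ₗ (cubeProjY i D ∘ₗ QpsY i parS U) ∘ₗ ClocY i parS D P U ∘ₗ (QpY i parS U ∘ₗ cubeProjY i D) ∘ₗ GsqY i parS D U := by
  have e1 : cubeProjY i D ∘ₗ GsqY i parS D U = GsqY i parS D U := cubeProjY_mul_GsqY i parS D U
  have e2 : GsqY i parS D U ∘ₗ cubeProjY i D = GsqY i parS D U := GsqY_mul_cubeProjY i parS D U
  symm
  rw [LinearMap.comp_assoc (GsqY i parS D U) (cubeProjY i D) (QpY i parS U), e1, LinearMap.comp_assoc _ (QpsY i parS U) (cubeProjY i D),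
    ← LinearMap.comp_assoc _ (cubeProjY i D) (GsqY i parS D U), e2, PlocY]

/-- ★ **`P_□(U)` IS LOCAL**. [cite: Balaban1985BackgroundPropagators, (3.105) p.414, p.410 L14–15] -/
theorem PlocY_congr {parS : SiteParY 𝔸 i} {D : Finset (SiteY i)} (P : Module.End ℂ (BlkY i → 𝔸)) {U U' : CfgY 𝔸 i}
    (hG : GsqY i parS D U = GsqY i parS D U') (hQ : QpAgreeY i parS D U U') : PlocY i parS D P U = PlocY i parS D P U' := by
  rw [PlocY_eq, PlocY_eq, QpY_comp_cubeProjY_congr fun z hz s hs => hQ z hz s (Or.inl hs),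
    cubeProjY_comp_QpsY_congr fun z hz s hs => hQ z hz s (Or.inr hs), ClocY_congr P hG hQ, hG]

/-- ★★ **THE LOCAL GAUGE PROJECTION `R_□(U)` IS LOCAL IN `U`** — as an OPERATOR it depends on `U` only through `G′_□(U)` and the
`Q′`-transporters at `D` (print: «G′_□ depends on U restricted to Ω₀(□) ⊂ □̃⁵», hence so do `C_□`, `P_□`, `R_□`).
[cite: Balaban1985BackgroundPropagators, (3.25) p.394, (3.105) p.414, p.410 L14–15] -/
theorem RlocY_congr {parS : SiteParY 𝔸 i} {D : Finset (SiteY i)} (P : Module.End ℂ (BlkY i → 𝔸)) {U U' : CfgY 𝔸 i}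
    (hG : GsqY i parS D U = GsqY i parS D U') (hQ : QpAgreeY i parS D U U') : RlocY i parS D P U = RlocY i parS D P U' := by
  rw [RlocY, RlocY, PlocY_congr P hG hQ]

/-- at a LOCAL transporter letter (`ParLocalY`, e.g. `parSY`, `parSymY`) both hypotheses follow from A-1's `AgreeNearY` and run agreement through
the block corners. [cite: Balaban1985BackgroundPropagators, (3.40) p.397, p.410 L14–15] -/
theorem qpAgreeY_of_parLocalY {parS : SiteParY 𝔸 i} (hpar : ParLocalY i parS) {D : Finset (SiteY i)} {U U' : CfgY 𝔸 i}
    (h : ∀ z ∈ D, ∀ s, (qpK i s z ≠ 0 ∨ qpsK i z s ≠ 0) → AgreeRunY i U U' (blkCornerY i s) z) : QpAgreeY i parS D U U' :=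
  fun z hz s hs => hpar (h z hz s hs)

/-! ## §4 The compression `M_χ Δ_{a,□}(U) M_χ`, its padding and the local bond inverse `G_□(U)` are local in `U` -/

variable (i) in
/-- **`Q`-transport agreement on `supp χ`**: the contour transporters `parB U (x(y), b₋)` agree on every pair (index bond `y`, fine bond `b`) of the
averaging kernel with `χ(b) ≠ 0`. [cite: Balaban1985BackgroundPropagators, (3.12)–(3.14) p.393, p.410 L14–15, dictionary] -/
def QAgreeY (parB : BondParY 𝔸 i) (χ : FBondY i → ℝ) (U U' : CfgY 𝔸 i) : Prop :=
  ∀ ι b, χ b ≠ 0 → qK i ι b ≠ 0 → parB U (embIter (ι.1.1 : ℕ) ι.1.2.src) b.src = parB U' (embIter (ι.1.1 : ℕ) ι.1.2.src) b.src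

variable (i) in
/-- **plaquette agreement around `supp χ`**: `U = U′` on the edges of every plaquette of the Hessian's rows through a bond of `supp χ`.
[cite: Balaban1985BackgroundPropagators, (3.10) p.392, p.410 L14–15, dictionary] -/
def PlaqAgreeNearY (χ : FBondY i → ℝ) (U U' : CfgY 𝔸 i) : Prop :=
  ∀ b p, χ b ≠ 0 → (cocurlK i b p ≠ 0 ∨ ∃ m, edgeY i p m = b) → PlaqAgreeY i U U' p

variable (i) in
/-- **bond agreement on `supp χ`**: `U(b) = U′(b)` whenever `χ(b) ≠ 0`. [cite: Balaban1985BackgroundPropagators, (3.3) p.390, dictionary] -/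
def BondAgreeY (χ : FBondY i → ℝ) (U U' : CfgY 𝔸 i) : Prop :=
  ∀ b : FBondY i, χ b ≠ 0 → U b.dir b.src = U' b.dir b.src

omit [CompleteSpace 𝔸] in
/-- a cut function vanishes where its multiplier does. [cite: Balaban1985BackgroundPropagators, (3.103) p.413, bookkeeping] -/
theorem cutMulY_apply_eq_zero {X : Type} [Fintype X] [DecidableEq X] {χ : X → ℝ} {x : X} (hx : χ x = 0) (Λ : X → 𝔸) :
    cutMulY χ Λ x = 0 := by
  rw [cutMulY_apply, hx, Complex.ofReal_zero, zero_smul]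

/-- ★★★ **THE COMPRESSION `M_χ Δ_{a,□}(U) M_χ` IS LOCAL IN `U`**: it depends on `U` only through `R_□(U)` (§3), the bond variables on `supp χ`,
the plaquette variables around `supp χ` and the `Q`-transporters on `supp χ` — for EVERY `parS`, `parB`, block projection `P` and cut-off `χ`.
[cite: Balaban1985BackgroundPropagators, (3.26) p.395, (3.105) p.414, p.410 L14–15 («depends on U restricted to Ω₀(□) ⊂ □̃⁵»), dictionary] -/
theorem compr_deltaALocY_congr {parS : SiteParY 𝔸 i} {parB : BondParY 𝔸 i} {D : Finset (SiteY i)} {P : Module.End ℂ (BlkY i → 𝔸)}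
    {χ : FBondY i → ℝ} {U U' : CfgY 𝔸 i} (hR : RlocY i parS D P U = RlocY i parS D P U') (hb : BondAgreeY i χ U U')
    (hp : PlaqAgreeNearY i χ U U') (hq : QAgreeY i parB χ U U') :
    cutMulY χ * deltaALocY i parS parB D P U * cutMulY χ = cutMulY χ * deltaALocY i parS parB D P U' * cutMulY χ := by
  refine LinearMap.ext fun f => funext fun b => ?_
  simp only [Module.End.mul_apply]
  by_cases hχ : χ b = 0
  · rw [cutMulY_apply_eq_zero hχ, cutMulY_apply_eq_zero hχ]
  rw [cutMulY_apply, cutMulY_apply]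
  congr 1
  -- the cut argument `g = M_χ f` vanishes off `supp χ`
  have hg : ∀ b', cutMulY χ f b' ≠ 0 → χ b' ≠ 0 := fun b' h h0 => h (cutMulY_apply_eq_zero h0 f)
  have hdiv : divY i U (cutMulY χ f) = divY i U' (cutMulY χ f) :=
    funext fun z => divY_apply_congr fun b' _ => ⟨rfl, fun h => hb b' (hg b' h)⟩
  have hQ : QY i parB U (cutMulY χ f) = QY i parB U' (cutMulY χ f) :=
    funext fun ι => QY_apply_congr fun b' hb' => ⟨rfl, fun h => hq ι b' (hg b' h) hb'⟩
  simp only [deltaALocY, LinearMap.add_apply, Pi.add_apply, LinearMap.coe_comp, Function.comp_apply]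
  rw [hessY_apply_congr (fun p hp' => hp b p hχ hp') (cutMulY χ f), hdiv, hR, gradY_apply_congr (hb b hχ) fun z _ => rfl, hQ,
    QsY_apply_congr fun ι hι => ⟨rfl, hq ι b hχ hι⟩]

/-- ★★ hence **THE PADDED COMPRESSION `M_χ Δ_{a,□}(U) M_χ + (1 − M_χ)` IS LOCAL IN `U`**. [cite: Balaban1985BackgroundPropagators, pp.408–409 (G_□), p.410 L14–15] -/
theorem padDeltaALocY_congr {parS : SiteParY 𝔸 i} {parB : BondParY 𝔸 i} {D : Finset (SiteY i)} {P : Module.End ℂ (BlkY i → 𝔸)}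
    {χ : FBondY i → ℝ} {U U' : CfgY 𝔸 i} (hR : RlocY i parS D P U = RlocY i parS D P U') (hb : BondAgreeY i χ U U')
    (hp : PlaqAgreeNearY i χ U U') (hq : QAgreeY i parB χ U U') :
    padDeltaALocY i parS parB D P (cutMulY χ) U = padDeltaALocY i parS parB D P (cutMulY χ) U' := by
  unfold padDeltaALocY dirPadY
  rw [compr_deltaALocY_congr hR hb hp hq]

/-- ★★ and **THE LOCAL BOND INVERSE `G_□(U)` IS LOCAL IN `U`** (print p.410 L14–15 for `G_□`). [cite: Balaban1985BackgroundPropagators, pp.408–409 (G_□), p.410 L14–15] -/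
theorem GAsqY_congr {parS : SiteParY 𝔸 i} {parB : BondParY 𝔸 i} {D : Finset (SiteY i)} {P : Module.End ℂ (BlkY i → 𝔸)}
    {χ : FBondY i → ℝ} {U U' : CfgY 𝔸 i} (hR : RlocY i parS D P U = RlocY i parS D P U') (hb : BondAgreeY i χ U U')
    (hp : PlaqAgreeNearY i χ U U') (hq : QAgreeY i parB χ U U') :
    GAsqY i parS parB D P (cutMulY χ) U = GAsqY i parS parB D P (cutMulY χ) U' :=
  GAsqY_congr_of_compr i parS parB D (compr_deltaALocY_congr hR hb hp hq)

/-- hence the unit loci agree. [cite: Balaban1985BackgroundPropagators, pp.408–409 (G_□), bookkeeping] -/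
theorem isUnit_padDeltaALocY_iff {parS : SiteParY 𝔸 i} {parB : BondParY 𝔸 i} {D : Finset (SiteY i)} {P : Module.End ℂ (BlkY i → 𝔸)}
    {χ : FBondY i → ℝ} {U U' : CfgY 𝔸 i} (hR : RlocY i parS D P U = RlocY i parS D P U') (hb : BondAgreeY i χ U U')
    (hp : PlaqAgreeNearY i χ U U') (hq : QAgreeY i parB χ U U') :
    IsUnit (padDeltaALocY i parS parB D P (cutMulY χ) U) ↔ IsUnit (padDeltaALocY i parS parB D P (cutMulY χ) U') := by
  rw [padDeltaALocY_congr hR hb hp hq]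

/-! ## §5 At the record's letters `parSymY`, `parBY`: the agreement predicate `AgreeNearBY` and the instance faces -/

/-- ★ def-Y's genuine contour transporter `parBY = U(Γ)` (taxi transporter) reads `U` exactly on the rung bonds of the taxi run `x → z`.
[cite: Balaban1985BackgroundPropagators, (3.12) p.393, (3.40) p.397] -/
theorem parBY_congr_of_agree {U U' : CfgY 𝔸 i} (x z : Site (PV d ℓ i.m i.K hd hL) 0)
    (h : ∀ r ∈ rungSites (taxiSteps (List.finRange (d + 1)) x z) x, U r.2.1 r.1 = U' r.2.1 r.1) : parBY i U x z = parBY i U' x z :=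
  parTaxiV_congr_of_agree x z h

variable (i) in
/-- ★★ **THE AGREEMENT PREDICATE OF THE GENUINE BOND INSTANCE** `AgreeNearBY i D χ U U′` — `U = U′` on exactly what `M_χ Δ_{a,□}(U) M_χ` reads at
the record's letters: (i) A-1's `AgreeNearY i D U U′` (the site letter `G′_□(U)`); (ii) the bonds of `supp χ` (`D_U`, `D*_U`); (iii) the edges of the
plaquettes of the Hessian's rows through `supp χ` (`Δ(U)` of (3.10)); (iv) the rung bonds of the taxi runs `x(y) → b₋` of the `Q(U)`-rows through
`supp χ` (`Q*(U)aQ(U)`); (v) the taxi runs `c(s) ⇄ z`, `z ∈ D`, of the `Q′(U)`-rows through `D` (`C_□`, `P_□`, `R_□`).  Print: all of it lies in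
`Ω₀(□) ⊂ □̃⁵` — the geometric inclusion (kernel supports ↦ cube neighbourhoods) is the cube cover's, NOT asserted here.
[cite: Balaban1985BackgroundPropagators, p.410 L14–15 («depend on U restricted to Ω₀(□) ⊂ □̃⁵»), p.408 (Ω_j(□)), dictionary] -/
def AgreeNearBY (D : Finset (SiteY i)) (χ : FBondY i → ℝ) (U U' : CfgY 𝔸 i) : Prop :=
  AgreeNearY i D U U' ∧ BondAgreeY i χ U U' ∧ PlaqAgreeNearY i χ U U' ∧
    (∀ (ι : IBondY i) (b : FBondY i), χ b ≠ 0 → qK i ι b ≠ 0 →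
      ∀ r ∈ rungSites (taxiSteps (List.finRange (d + 1)) (embIter (ι.1.1 : ℕ) ι.1.2.src) b.src) (embIter (ι.1.1 : ℕ) ι.1.2.src),
        U r.2.1 r.1 = U' r.2.1 r.1) ∧
    (∀ z ∈ D, ∀ s, (qpK i s z ≠ 0 ∨ qpsK i z s ≠ 0) → AgreeRunY i U U' (blkCornerY i s) z)

/-- clause (iv) gives the `Q`-transport agreement of the genuine contour transporter. [cite: Balaban1985BackgroundPropagators, (3.12) p.393, (3.40) p.397] -/
theorem AgreeNearBY.qAgreeY {D : Finset (SiteY i)} {χ : FBondY i → ℝ} {U U' : CfgY 𝔸 i} (h : AgreeNearBY i D χ U U') :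
    QAgreeY i (parBY i) χ U U' :=
  fun ι b hχ hq => parBY_congr_of_agree _ _ (h.2.2.2.1 ι b hχ hq)

/-- clauses (i), (v) give `R_□(U) = R_□(U′)` at the record's symmetrised site transporter, for every block projection `P`.
[cite: Balaban1985BackgroundPropagators, (3.105) p.414, p.410 L14–15] -/
theorem AgreeNearBY.rlocY_parSymY {D : Finset (SiteY i)} {χ : FBondY i → ℝ} {U U' : CfgY 𝔸 i} (h : AgreeNearBY i D χ U U')
    (P : Module.End ℂ (BlkY i → 𝔸)) : RlocY i (parSymY i) D P U = RlocY i (parSymY i) D P U' :=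
  RlocY_congr P (GsqY_congr_of_parLocalY (parLocalY_parSymY i) h.1) (qpAgreeY_of_parLocalY (parLocalY_parSymY i) h.2.2.2.2)

/-- ★★★ **`padDeltaALocY_parSymY_congr` — THE PADDED COMPRESSION OF `Δ_{a,□}(U)` AT THE RECORD'S LETTERS IS LOCAL IN `U`**: for every cube `D`,
block projection `P` and bond cut-off `χ`, `M_χ Δ_{a,□}(U) M_χ + (1 − M_χ) = M_χ Δ_{a,□}(U′) M_χ + (1 − M_χ)` whenever `AgreeNearBY i D χ U U′`
(n06-j's FACE (d): the «U ↦ U′ agreeing near □̃» step of p.416's road to (3.35) on the cube).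
[cite: Balaban1985BackgroundPropagators, pp.408–409 (G_□), p.410 L14–15, p.416, dictionary] -/
theorem padDeltaALocY_parSymY_congr {D : Finset (SiteY i)} (P : Module.End ℂ (BlkY i → 𝔸)) {χ : FBondY i → ℝ} {U U' : CfgY 𝔸 i}
    (h : AgreeNearBY i D χ U U') :
    padDeltaALocY i (parSymY i) (parBY i) D P (cutMulY χ) U = padDeltaALocY i (parSymY i) (parBY i) D P (cutMulY χ) U' :=
  padDeltaALocY_congr (h.rlocY_parSymY P) h.2.1 h.2.2.1 h.qAgreeY

/-- ★★ the compression itself: `M_χ Δ_{a,□}(U) M_χ = M_χ Δ_{a,□}(U′) M_χ` at the record's letters. [cite: Balaban1985BackgroundPropagators, (3.105) p.414, p.410 L14–15] -/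
theorem compr_deltaALocY_parSymY_congr {D : Finset (SiteY i)} (P : Module.End ℂ (BlkY i → 𝔸)) {χ : FBondY i → ℝ} {U U' : CfgY 𝔸 i}
    (h : AgreeNearBY i D χ U U') :
    cutMulY χ * deltaALocY i (parSymY i) (parBY i) D P U * cutMulY χ = cutMulY χ * deltaALocY i (parSymY i) (parBY i) D P U' * cutMulY χ :=
  compr_deltaALocY_congr (h.rlocY_parSymY P) h.2.1 h.2.2.1 h.qAgreeY

/-- ★★ **`G_□(U) = G_□(U′)` at the record's letters** whenever `AgreeNearBY i D χ U U′` (print p.410 L14–15 for `G_□`).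
[cite: Balaban1985BackgroundPropagators, pp.408–409 (G_□), p.410 L14–15] -/
theorem GAsqY_parSymY_congr {D : Finset (SiteY i)} (P : Module.End ℂ (BlkY i → 𝔸)) {χ : FBondY i → ℝ} {U U' : CfgY 𝔸 i}
    (h : AgreeNearBY i D χ U U') :
    GAsqY i (parSymY i) (parBY i) D P (cutMulY χ) U = GAsqY i (parSymY i) (parBY i) D P (cutMulY χ) U' :=
  GAsqY_congr (h.rlocY_parSymY P) h.2.1 h.2.2.1 h.qAgreeY

/-- and the unit loci of the padded compressions agree. [cite: Balaban1985BackgroundPropagators, pp.408–409 (G_□), bookkeeping] -/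
theorem isUnit_padDeltaALocY_parSymY_iff {D : Finset (SiteY i)} (P : Module.End ℂ (BlkY i → 𝔸)) {χ : FBondY i → ℝ} {U U' : CfgY 𝔸 i}
    (h : AgreeNearBY i D χ U U') :
    IsUnit (padDeltaALocY i (parSymY i) (parBY i) D P (cutMulY χ) U) ↔ IsUnit (padDeltaALocY i (parSymY i) (parBY i) D P (cutMulY χ) U') := by
  rw [padDeltaALocY_parSymY_congr P h]

/-- `AgreeNearBY` is symmetric in the configurations. [cite: Balaban1985BackgroundPropagators, p.410 L14–15, bookkeeping] -/
theorem AgreeNearBY.symm {D : Finset (SiteY i)} {χ : FBondY i → ℝ} {U U' : CfgY 𝔸 i} (h : AgreeNearBY i D χ U U') :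
    AgreeNearBY i D χ U' U :=
  ⟨h.1.symm, fun b hb => (h.2.1 b hb).symm, fun b p hb hp => (h.2.2.1 b p hb hp).symm,
    fun ι b hb hq r hr => (h.2.2.2.1 ι b hb hq r hr).symm, fun z hz s hs => (h.2.2.2.2 z hz s hs).symm⟩

/-- `AgreeNearBY` is monotone in the cut-off's support: a cut-off supported inside `supp χ` reads no more. [cite: Balaban1985BackgroundPropagators, p.410 L14–15, bookkeeping] -/
theorem AgreeNearBY.mono {D : Finset (SiteY i)} {χ χ' : FBondY i → ℝ} {U U' : CfgY 𝔸 i} (h : AgreeNearBY i D χ U U')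
    (hχ : ∀ b, χ' b ≠ 0 → χ b ≠ 0) : AgreeNearBY i D χ' U U' :=
  ⟨h.1, fun b hb => h.2.1 b (hχ b hb), fun b p hb hp => h.2.2.1 b p (hχ b hb) hp, fun ι b hb hq => h.2.2.2.1 ι b (hχ b hb) hq, h.2.2.2.2⟩

end Letters

end Literature.MathematicalPhysics.QuantumFieldTheory.Balaban1983to89.Node00.OpsYDeltaALocalAgree
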